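import Summits.CriticalPhenomena.PercolationContinuityZ3.Theorems.PercNearOneGluingNoHeavyLowerTailNineTypeRadical

/-!
# Nine-type programme for `Q44b`: the radical certificate with extra co-rows

Support file for crux `stmt-CriticalPhenomena-4575` (`Q44b`, GF(2)-rank line of `prim-bnk-1`), seat `prim-bnk-1` gen 19;
memo `run/shared/lean/prim/prim-l12/FROM-prim-bnk-1-gen19-HALL-GRAM-ASSEMBLY.md` §9–§10.

`NineType.radical_certificate₂` extends `NineType.radical_certificate`: the half-sum detector of a family `Y` with top `t`
also kills the L-rows of any family `Rc` of sets `r` with `y ∪ rᶜ` good and `r ⊄ y` for all `y ∈ Y`; hence H-rows of `S`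
plus L-rows of `Rc` never represent the L-row of `t`.  This is the triangularity step of the K3 assembly for pure circuits
(`…NineTypePureCount`).  Also the table fact `hlOK_self`.  Pure finite combinatorics; no sorries, standard axioms.
-/

namespace Summit.CriticalPhenomena.PercolationContinuityZ3.Theorems

namespace NineType

open Finset

variable {α : Type*} [DecidableEq α] [Fintype α]

/-- **Radical certificate with extra co-rows.**  As `radical_certificate`, but the represented vector may also contain
the L-rows of a family `Rc` none of whose members lies in a member of `Y` and with `y ∪ rᶜ ∈ 𝔊`: the half-sum of `Y`
kills those L-rows too, so `S`-rows plus `Rc`-co-rows cannot represent the L-row of `t`. [this work] -/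
theorem radical_certificate₂ (𝔊 : Finset (Finset α))
    (hG : ∀ g ∈ 𝔊, ∀ g' : Finset α, g ⊆ g' → g' ∈ 𝔊)
    (Y : Finset (Finset α)) (t : Finset α) (ht : t ∈ Y)
    (hHL : ∀ y ∈ Y, y ∪ tᶜ ∈ 𝔊) (hmax : ∀ y ∈ Y, t ⊆ y → y = t)
    (S Rc : Finset (Finset α))
    (hrad : ∀ s ∈ S, (∑ u ∈ 𝔊.filter (fun u => s ⊆ u),
      ((#(Y.filter (fun y => y ⊆ u)) : ℕ) : ZMod 2)) = 0)
    (hRc : ∀ r ∈ Rc, ∀ y ∈ Y, y ∪ rᶜ ∈ 𝔊 ∧ ¬ r ⊆ y) :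
    ¬ (∀ g ∈ 𝔊, ((#(S.filter (fun s => s ⊆ g)) : ℕ) : ZMod 2)
        + ((#(Rc.filter (fun r => rᶜ ⊆ g)) : ℕ) : ZMod 2) = if tᶜ ⊆ g then 1 else 0) := by
  intro hrel
  set σ : Finset α → ZMod 2 := fun u => ((#(Y.filter (fun y => y ⊆ u)) : ℕ) : ZMod 2) with hσ
  -- the co-rows of Rc are killed by σ
  have hkill : ∀ r ∈ Rc, (∑ u ∈ 𝔊.filter (fun u => rᶜ ⊆ u), σ u) = 0 := by
    intro r hr
    calc (∑ u ∈ 𝔊.filter (fun u => rᶜ ⊆ u), σ u)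
        = ∑ u ∈ 𝔊, (if rᶜ ⊆ u then σ u else 0) := by rw [Finset.sum_filter]
      _ = ∑ u ∈ 𝔊, ∑ y ∈ Y, (if y ∪ rᶜ ⊆ u then (1 : ZMod 2) else 0) := by
          refine Finset.sum_congr rfl fun u _ => ?_
          by_cases hru : rᶜ ⊆ u
          · rw [if_pos hru, hσ]
            simp only
            rw [card_filter_cast]
            refine Finset.sum_congr rfl fun y _ => ?_
            by_cases hyu : y ⊆ u
            · rw [if_pos hyu, if_pos (Finset.union_subset hyu hru)]
            · rw [if_neg hyu, if_neg (fun h => hyu (subset_union_left.trans h))]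
          · rw [if_neg hru]; symm
            refine Finset.sum_eq_zero fun y _ => ?_
            rw [if_neg (fun h => hru (subset_union_right.trans h))]
      _ = ∑ y ∈ Y, ∑ u ∈ 𝔊, (if y ∪ rᶜ ⊆ u then (1 : ZMod 2) else 0) := Finset.sum_comm
      _ = ∑ y ∈ Y, (0 : ZMod 2) := by
          refine Finset.sum_congr rfl fun y hy => ?_
          rw [← card_filter_cast, card_supersets_parity 𝔊 hG (y ∪ rᶜ) (hRc r hr y hy).1, if_neg]
          intro huniv
          apply (hRc r hr y hy).2
          intro x hx
          have hx' : x ∈ y ∪ rᶜ := by rw [huniv]; exact Finset.mem_univ x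
          rcases Finset.mem_union.1 hx' with h | h
          · exact h
          · exact absurd hx (Finset.mem_compl.1 h)
      _ = 0 := Finset.sum_const_zero
  -- D := Σ_u σ(u)·(#S(u) + #Rc(u)); first via the relation (= 1, as in `radical_certificate`)
  have h1 : ∑ u ∈ 𝔊, σ u * (((#(S.filter (fun s => s ⊆ u)) : ℕ) : ZMod 2)
      + ((#(Rc.filter (fun r => rᶜ ⊆ u)) : ℕ) : ZMod 2)) = 1 := by
    calc ∑ u ∈ 𝔊, σ u * (((#(S.filter (fun s => s ⊆ u)) : ℕ) : ZMod 2)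
          + ((#(Rc.filter (fun r => rᶜ ⊆ u)) : ℕ) : ZMod 2))
        = ∑ u ∈ 𝔊, σ u * (if tᶜ ⊆ u then (1 : ZMod 2) else 0) := by
          refine Finset.sum_congr rfl fun u hu => ?_
          rw [hrel u hu]
      _ = ∑ u ∈ 𝔊, ∑ y ∈ Y, (if y ∪ tᶜ ⊆ u then (1 : ZMod 2) else 0) := by
          refine Finset.sum_congr rfl fun u _ => ?_
          rw [hσ]
          simp only
          rw [card_filter_cast, Finset.sum_mul]
          refine Finset.sum_congr rfl fun y _ => ?_
          by_cases hyu : y ⊆ u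
          · by_cases htu : tᶜ ⊆ u
            · rw [if_pos hyu, if_pos htu, if_pos (Finset.union_subset hyu htu), one_mul]
            · rw [if_pos hyu, if_neg htu, if_neg (fun h => htu (subset_union_right.trans h)), mul_zero]
          · rw [if_neg hyu, if_neg (fun h => hyu (subset_union_left.trans h)), zero_mul]
      _ = ∑ y ∈ Y, ∑ u ∈ 𝔊, (if y ∪ tᶜ ⊆ u then (1 : ZMod 2) else 0) := Finset.sum_comm
      _ = ∑ y ∈ Y, (if y = t then (1 : ZMod 2) else 0) := by
          refine Finset.sum_congr rfl fun y hy => ?_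
          rw [← card_filter_cast, card_supersets_parity 𝔊 hG (y ∪ tᶜ) (hHL y hy)]
          by_cases hyt : y = t
          · rw [if_pos hyt, if_pos]; rw [hyt]; exact Finset.union_compl t
          · rw [if_neg hyt, if_neg]
            intro huniv; apply hyt; apply hmax y hy
            intro x hx
            have hx' : x ∈ y ∪ tᶜ := by rw [huniv]; exact Finset.mem_univ x
            rcases Finset.mem_union.1 hx' with h | h
            · exact h
            · exact absurd hx (Finset.mem_compl.1 h)
      _ = 1 := by rw [Finset.sum_ite_eq' Y t, if_pos ht]
  -- second evaluation: S-part vanishes by hrad, Rc-part by hkill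
  have h2 : ∑ u ∈ 𝔊, σ u * (((#(S.filter (fun s => s ⊆ u)) : ℕ) : ZMod 2)
      + ((#(Rc.filter (fun r => rᶜ ⊆ u)) : ℕ) : ZMod 2)) = 0 := by
    have hS : ∑ u ∈ 𝔊, σ u * (((#(S.filter (fun s => s ⊆ u)) : ℕ) : ZMod 2)) = 0 := by
      calc ∑ u ∈ 𝔊, σ u * (((#(S.filter (fun s => s ⊆ u)) : ℕ) : ZMod 2))
          = ∑ u ∈ 𝔊, ∑ s ∈ S, (if s ⊆ u then σ u else 0) := by
            refine Finset.sum_congr rfl fun u _ => ?_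
            rw [card_filter_cast, Finset.mul_sum]
            refine Finset.sum_congr rfl fun s _ => ?_
            by_cases hsu : s ⊆ u
            · rw [if_pos hsu, if_pos hsu, mul_one]
            · rw [if_neg hsu, if_neg hsu, mul_zero]
        _ = ∑ s ∈ S, ∑ u ∈ 𝔊, (if s ⊆ u then σ u else 0) := Finset.sum_comm
        _ = ∑ s ∈ S, ∑ u ∈ 𝔊.filter (fun u => s ⊆ u), σ u := by
            refine Finset.sum_congr rfl fun s _ => ?_; rw [Finset.sum_filter]
        _ = 0 := Finset.sum_eq_zero fun s hs => hrad s hs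
    have hR : ∑ u ∈ 𝔊, σ u * (((#(Rc.filter (fun r => rᶜ ⊆ u)) : ℕ) : ZMod 2)) = 0 := by
      calc ∑ u ∈ 𝔊, σ u * (((#(Rc.filter (fun r => rᶜ ⊆ u)) : ℕ) : ZMod 2))
          = ∑ u ∈ 𝔊, ∑ r ∈ Rc, (if rᶜ ⊆ u then σ u else 0) := by
            refine Finset.sum_congr rfl fun u _ => ?_
            rw [card_filter_cast, Finset.mul_sum]
            refine Finset.sum_congr rfl fun r _ => ?_
            by_cases hru : rᶜ ⊆ u
            · rw [if_pos hru, if_pos hru, mul_one]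
            · rw [if_neg hru, if_neg hru, mul_zero]
        _ = ∑ r ∈ Rc, ∑ u ∈ 𝔊, (if rᶜ ⊆ u then σ u else 0) := Finset.sum_comm
        _ = ∑ r ∈ Rc, ∑ u ∈ 𝔊.filter (fun u => rᶜ ⊆ u), σ u := by
            refine Finset.sum_congr rfl fun r _ => ?_; rw [Finset.sum_filter]
        _ = 0 := Finset.sum_eq_zero fun r hr => hkill r hr
    simp only [mul_add, Finset.sum_add_distrib, hS, hR, add_zero]
  rw [h2] at h1
  exact zero_ne_one h1

/-- Table fact: every type is HL-compatible with itself (`s ∪ sᶜ = univ` is good). -/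
theorem hlOK_self (x : ℕ) (hx : 1 ≤ x ∧ x ≤ 9) : hlOK x x = true := by
  rcases hx with ⟨h1, h9⟩
  interval_cases x <;> decide

end NineType

end Summit.CriticalPhenomena.PercolationContinuityZ3.Theorems
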